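import Mathlib.Analysis.Convex.Hull
import Literature.Probability.LatticeModels.LatticeGraph
import Literature.Probability.LatticeModels.CorrelationDecay
import Literature.Probability.Percolation.Percolation
import Literature.Probability.Percolation.Crossings
import Literature.Probability.LatticeModels.IsoradialGraphs
import Literature.Probability.LatticeModels.IsoradialPercolation
import Literature.Probability.LatticeModels.IsoradialSquareGrid
import Literature.Probability.Percolation.IsoradialArmUniversality
import HarnessLib

-- provenance: harness21/H21/H21/Statements/CritPerc/Isoradial.lean @ bdfa61e (interim HEAD d8f2665); M5 mechanical rewrite
/-!
# Critical bond percolation on isoradial graphs (Grimmett–Manolescu)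

Trunk: StatMech; family CritPerc; statement file for **crit-perc.S24**. The id is carried by
`gm_boxCrossingBounds_uniform`, `gm_boxCrossing`, `gm_theta_critical_eq_zero`,
`gm_universality_oneArm`, `gm_universality_arms` and `isoradialPercolation_square_eq`
(six occurrences of one statement id).

Informal content (Grimmett–Manolescu, *Bond percolation on isoradial graphs: criticality and
universality*, PTRF 159 (2014) 273–327, Thms 1.1–1.2; the inhomogeneous square / triangular /
hexagonal case is Grimmett–Manolescu, Ann. Probab. 41 (2013) 2990–3025). Let `𝒢` be the class
of (connected, planar) isoradial graphs with the bounded-angles property and the square-grid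
property, each equipped with its *canonical* bond percolation measure `P_G` (edge `e` open
with the angle-dependent probability `p_e` of GM (1.3), `criticalWeight`). Then
* (Thm 1.1(a)) every `G ∈ 𝒢` is *critical*: `P_G` has the box-crossing (RSW) property, with
  constants depending on `G ∈ 𝒢(ε, I)` (bounded angles BAP(ε) and square grid SGP(I)) only
  through `(ε, I)` (*uniformly* in the class `𝒢(ε, I)`; arXiv §3, (3.1)), and consequently
  `θ(P_G) = 0` (no infinite open cluster a.s.). (GM also note that `P_G` is not
  subcritical; that half is *not* stated here.)
* (Thm 1.1(b), Thm 1.2) *universality*: if the one-arm exponent `ρ₁` or an alternating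
  `2j`-arm exponent `ρ_{2j}` (`j ≥ 1`) exists for some `G₀ ∈ 𝒢`, then it exists and takes the
  same value for every `G ∈ 𝒢`.
The square lattice `ℤ²` at `p = 1/2` belongs to `𝒢` (`isoradialPercolation_square_eq`,
`isIsoradial_squareLatticeEmbedding`, `hasBoundedAngles_squareLatticeEmbedding`,
`hasSquareGridPropertyGM_squareLattice` (SGP(1), §4.3.1; the H21 rendering
`hasSquareGridProperty_squareLattice` serves the superseded bodies quoted in the `History`
paragraphs),
`isRhombicTiling_squareLatticeEmbedding`, `zdGraph_preconnected`).

Restatements (2026-08-15; verdicts of the `provefact` seats, re-verified against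
arXiv:1204.0505 for this clean-up; human ruling "restate, keep the name when the correction
sharpens hypotheses / fixes a quantifier"). Four of the original transcriptions were **stated
stronger than their source**, and the fifth (`gm_universality_arms`) was moreover not the
statement of its source at all for `j ≥ 2`; all have been corrected *in place*, under their
ledger-referenced names; the superseded bodies are quoted in the `History` paragraph of each
docstring:
* `gm_boxCrossingBounds_uniform`: the constants are now chosen *after* the square-grid
  parameter `I` — printed (3.1): "for `ε > 0` and `I ∈ ℕ` there exists `δ = δ(ε, I) > 0` such
  that if `G` satisfies BAP(ε) and SGP(I), `P_G` satisfies BXP(δ)" — and the square-grid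
  hypothesis is the printed SGP(I), `RhombicEmbedding.SquareGridPropertyGM I`
  (`IsoradialSquareGrid`), instead of the strictly weaker H21 rendering
  `RhombicEmbedding.HasSquareGridProperty` with `I`-free constants.
* `gm_universality_oneArm`: the square-grid hypothesis is the printed SGP
  (`RhombicEmbedding.HasSquareGridPropertyGM`) both for the graph concluded about and for the
  witness `G₀`, and `Countable V`, `G.LocallyFinite` are bound explicitly (§3 Theorem
  "Universality" (a) is about the printed class `𝒢`; its proof, §8.1 and §8.4, uses clause (b)
  of SGP(I), which the H21 rendering drops).
* `gm_boxCrossing` and `gm_theta_critical_eq_zero` (later the same day, on review of the fact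
  `gm_theta_critical_eq_zero`): the square-grid hypothesis is the printed SGP,
  `RhombicEmbedding.HasSquareGridPropertyGM` ("SGP(I) for some `I`", §4.2), instead of the H21
  rendering `RhombicEmbedding.HasSquareGridProperty`; everything else verbatim. The two were
  restated together because the companion file `IsoradialCriticalityProofs` derives the second
  from the first (`gm_theta_critical_eq_zero_of_gm_boxCrossing`: Theorem "Criticality" (b) from
  the box-crossing Theorem, as in the source, end of §3), feeding the square-grid hypothesis of
  the one to the other.
The records of the discrepancies, written before the restatements, are the companion files
`IsoradialPrintedBXP` and `IsoradialPrintedSGP` (theorems `….toGM`, whose conclusions are the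
present bodies), the module docstring of `IsoradialBoxCrossingGM` (whose displayed statement
`gm_boxCrossingGM` is the present body of `gm_boxCrossing`) and the section "The statement of
`gm_theta_critical_eq_zero` against its source" of `IsoradialCriticalityProofs` (theorem
`gm_theta_critical_eq_zero.toGM`, whose conclusion is the present body).
* `gm_universality_arms` (later the same day, review of its verdict *misstated*): here no
  sharpening of hypotheses sufficed — the arm event of the original transcription, the prelude's
  `embArmEvent (alternatingColours j)`, imposes no cyclic order on the arms and is, for `j ≥ 2`,
  a strictly larger event than the source's `A_{2j}(N, n)` ("`2j` vertex-disjoint crossings with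
  colours `1, 0, 1, 0, …` *taken in anticlockwise order*", §3), outside the scope of the theorem
  (see the `History` paragraph of the fact, (D1)). The body is now **the corrected statement**
  that the companion files had recorded as text (`gm_universality_altArms` in the module
  docstring of `IsoradialArmUniversality`, before this restatement): the event is the
  cluster-separated alternating event `RhombicEmbedding.embAltArmEvent j` of
  `IsoradialArmUniversality` (imported for this purpose; the rendering of `A_{2j}` in the form
  `x_i ↔ y_i`, `x_i ↮ x_{i'}` of §8.2), in hypothesis and conclusion, the square-grid hypothesis
  is the printed SGP for `G` and for the witness `G₀`, and `Countable V`, `G.LocallyFinite` are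
  bound explicitly, exactly as for `gm_universality_oneArm`. The name is kept because the ledger
  (crit-perc.S24) refers to it and no term-level user of the old body remains; the records are
  `IsoradialArmUniversality` (module docstring) and `IsoradialPrintedArms` (an explicit
  configuration on `√2 ℤ²` separating the two events at `j = 2`, and their identity at `j = 1`),
  and the corrected statement is proved from Proposition 22 (§8.1) for centred embeddings on
  `Type` in `IsoradialExponentUniversality` (`gm_universality_altArms_centred`).

Design choices.
* The class `𝒢` is rendered by *real* Props: an embedding `emb : RhombicEmbedding G F` of a
  preconnected graph `G` (`G.Preconnected`; GM's isoradial graphs are connected by definition,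
  §2.1) with `emb.IsIsoradial`, `emb.IsRhombicTiling` (the rhombi of distinct edges have
  disjoint interiors, the rhombi *cover* the plane, and faces are identified with their
  centres, `c` injective — together the rhombic-tiling condition of GM §2.1, "`G` is
  isoradial iff its diamond graph `G^◇` is a rhombic tiling", which `IsIsoradial` alone does
  not impose, see the module docstring of `IsoradialGraphs`), `emb.HasBoundedAngles ε`
  (`0 < ε`) and the square-grid property — as printed, `emb.SquareGridPropertyGM I` (uniform
  fact) / `emb.HasSquareGridPropertyGM` (`IsoradialSquareGrid`) in all five facts since their
  restatement (the H21 rendering `emb.HasSquareGridProperty` survives only in the superseded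
  bodies quoted in the `History` paragraphs) —; no abstract Prop parameter and no stub (outline
  R7). Without disjointness, superposed translated copies of `ℤ²` would satisfy all other
  hypotheses (review r02335B); without covering, periodic strict subgraphs of `ℤ²` (with
  `p_c > 1/2`) would; without injectivity of `c`, "split faces" would make the dual open graph
  a strict subgraph of the dual lattice (review r02421A) — each refuting box-crossing or
  universality. `Countable V` and `G.LocallyFinite` are carried as standing hypotheses of the
  class (every isoradial graph is a locally finite countable planar graph). The Prop
  `IsRhombicTiling` may eventually be moved to the prelude `IsoradialGraphs`.
* The *uniform* box-crossing statement of Thm 1.1(a) (`gm_boxCrossingBounds_uniform`) chooses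
  the constants `c, n₀` of `BoxCrossingBounds` after `(ε, I, ρ)` and before the graph, as
  printed ((3.1): `δ = δ(ε, I)`), quantifying over graphs on `Type` (universe 0, which contains
  every countable graph up to isomorphism) in the printed class `𝒢(ε, I)`; `gm_boxCrossing` is
  the per-graph form (`HasBoxCrossingProperty`), universe-polymorphic.
* "Arm exponent exists" is the log-ratio limit `HasDecayExponent` of `CorrelationDecay`
  (`P n = n^{-α + o(1)}`), applied to `μ.real` of the embedded events: `embOneArm` of
  `IsoradialPercolation` for the one-arm exponent and, for the alternating `2j`-arm exponents,
  `RhombicEmbedding.embAltArmEvent` of `IsoradialArmUniversality` (sup-norm boxes `Λ_n`, slack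
  `2`, outline §0; cyclic alternation encoded by cluster separation inside the annulus, GM
  §8.2). For the `2j`-arm events the inner radius is "large enough, then fixed"
  (`∃ r₁, ∀ r₀ ≥ r₁`), as in `ArmExponents` (crit-perc.S15).
* Universality is stated in the implication form "exists for some `G₀ ∈ 𝒢` ⟹ holds with the
  same value for `G`"; the witness `G₀` is quantified over `Type` (universe 0).
* `θ(p_c) = 0` is stated vertexwise: `P_G(x ↔ ∞) = 0` for every vertex `x` (`percolatesAt`).

Mathlib search: Mathlib has `convexHull`, `interior`, `Pairwise`, `Disjoint`, `Set.iUnion`,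
`Function.Injective` (used for `rhombus`/`IsRhombicTiling`) and nothing on isoradial graphs,
rhombic tilings, crossing events or arm exponents (`rg -i isoradial`, `rg -i rhombic`,
`rg -i "arm event"` in Mathlib return nothing); the percolation measure and events come from
the H21 StatMech prelude. The two auxiliary definitions `RhombicEmbedding.rhombus` and
`RhombicEmbedding.IsRhombicTiling` are deliberate dot-notation extensions of the H21
prelude's structure `Literature.Probability.LatticeModels.RhombicEmbedding` (they may be moved
to `IsoradialGraphs`).
-/

noncomputable section

open MeasureTheory ProbabilityTheory

/-! ### Rhombi and the tiling condition -/

namespace Literature.Probability.Percolation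
section RhombicEmbedding
open Literature.Probability.LatticeModels (RhombicEmbedding)
open Literature.Probability.LatticeModels.RhombicEmbedding

variable {V : Type*} {G : SimpleGraph V} {F : Type*} (emb : RhombicEmbedding G F)

/-- The closed rhombus of the edge `e = s(x, y)`: the convex hull of its four corners, the two
endpoints `z x, z y` and the two adjacent face centres `c f, c g` (read off from the reference
dart `refDart e`; the corner *set* does not depend on the orientation under `IsIsoradial`).
(Kenyon–Schlenker 2005, §1; Grimmett–Manolescu 2014, §2.1, the diamond graph `G^◇`.)
[cite: KenyonSchlenker2005TAMS, §1] -/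
def _root_.Literature.Probability.LatticeModels.RhombicEmbedding.rhombus (e : G.edgeSet) : Set ℂ :=
  convexHull ℝ {emb.z (refDart e).fst, emb.c (emb.leftFace (refDart e)),
    emb.z (refDart e).snd, emb.c (emb.rightFace (refDart e))}

/-- The *rhombic-tiling condition*: the rhombi of distinct edges have disjoint interiors
(planarity), the rhombi cover the plane, and distinct faces have distinct centres (faces are
identified with the tiles' dual corners). Together with `IsIsoradial` this says exactly that
the diamond graph `G^◇` is a rhombic tiling of the plane with primal graph `G`
(Grimmett–Manolescu 2014, §2.1: "`G` is isoradial if and only if its diamond graph is a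
rhombic tiling"; Kenyon–Schlenker 2005, §1). It excludes superposed translated copies of an
isoradial graph, strict subgraphs of a rhombic tiling (which fail to cover), and "split
faces" (two labels with one centre), all of which satisfy `IsIsoradial` dart by dart.
[cite: GrimmettManolescu2014Isoradial, §2.1 (isoradial iff rhombic tiling)] -/
structure _root_.Literature.Probability.LatticeModels.RhombicEmbedding.IsRhombicTiling : Prop where
  /-- Rhombi of distinct edges have disjoint interiors. -/
  disjoint_interior : Pairwise fun e e' : G.edgeSet =>
    Disjoint (interior (emb.rhombus e)) (interior (emb.rhombus e'))
  /-- The rhombi cover the plane. -/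
  iUnion_rhombus : ⋃ e : G.edgeSet, emb.rhombus e = Set.univ
  /-- Faces are determined by their centres. -/
  c_injective : Function.Injective emb.c

end RhombicEmbedding
end Literature.Probability.Percolation

namespace Literature.Probability.Percolation

/-- The rhombi (squares of side `√2`, one per edge, with the edge as a diagonal) of the
isoradial embedding of `ℤ²` have pairwise disjoint interiors and tile the plane, and the face
centres `(a + 1/2) + (b + 1/2) i` are pairwise distinct.
(Grimmett–Manolescu 2014, §2.1, the square lattice as an isoradial graph.)
[cite: GrimmettManolescu2014Isoradial, §2.1 (the square lattice as an isoradial graph)] -/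
def isRhombicTiling_squareLatticeEmbedding : Prop :=
  LatticeModels.squareLatticeEmbedding.IsRhombicTiling

end Literature.Probability.Percolation

namespace Literature.Probability.Percolation

open LatticeModels Percolation

/-- The alternating colour sequence open/closed/open/…/closed of length `2j`
(`true` = primal open arm, `false` = dual open arm), indexing the `2j`-arm events whose
exponents `ρ_{2j}` appear in Grimmett–Manolescu 2014, Thm 1.1(b).
[cite: GrimmettManolescu2014Isoradial, §3 Theorem "Universality" (exponents ρ_{2j})] -/
def alternatingColours (j : ℕ) : Fin (2 * j) → Bool := fun i => decide (Even (i : ℕ))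

/-- Unfolding `alternatingColours`: arm `i` is primal-open iff `i` is even.
(Grimmett–Manolescu 2014, Thm 1.1(b), alternating arm events.)
[cite: GrimmettManolescu2014Isoradial, §3 Theorem "Universality" (exponents ρ_{2j})] -/
theorem alternatingColours_apply (j : ℕ) (i : Fin (2 * j)) :
    alternatingColours j i = decide (Even (i : ℕ)) := rfl

/-- **crit-perc.S24** (uniform box-crossing property; Grimmett–Manolescu, PTRF 159 (2014)
273–327 = arXiv:1204.0505, §3, Theorem 3.1 — "For `G ∈ 𝒢`, `P_G` possesses the box-crossing
property" — in its uniform form, display (3.1): "for `ε > 0` and `I ∈ ℕ` there exists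
`δ = δ(ε, I) > 0` such that: if `G` satisfies BAP(ε) and SGP(I), `P_G` satisfies BXP(δ)";
likewise after the Theorem "Criticality": "constants that depend only on `ε`, `I`, and not
further on `G`"). Here BAP(ε) is the bounded-angles property of §2.1 (tree:
`HasBoundedAngles ε`, GM's BAP(2ε) under `θ_e = π - 2·halfAngle`; immaterial since `ε > 0`
is arbitrary), SGP(I) is the square-grid property **as printed** in §4.2 — the track-set
partitioned as `S ∪ T₁ ∪ T₂` with clauses (a)–(c); tree: `RhombicEmbedding.SquareGridPropertyGM I`
of `IsoradialSquareGrid` — and BXP(δ) is the box-crossing property of §2.3 (Definition 2.2,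
`l₀ = 3`). Statement: for every `ε > 0`, `I : ℕ` and aspect ratio `ρ > 0` there are `c > 0`
and `n₀`, depending only on `(ε, I, ρ)`, such that for *every* preconnected graph `G` on a type
in `Type` (universe 0), isoradially and rhombically embedded with `HasBoundedAngles ε` and
`SquareGridPropertyGM I`, the canonical measure `P_G` crosses `w + [0, ρ n] × [0, n]`
horizontally and `w + [0, n] × [0, ρ n]` vertically with probability in `[c, 1 - c]`, for all
translations `w ∈ ℂ` and all `n ≥ n₀` (`BoxCrossingBounds`). Two uniformities: in `(w, n)`
inside `BoxCrossingBounds`, and in `G ∈ 𝒢(ε, I)` by the order of quantifiers. The rendering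
`BoxCrossingBounds` (all aspect ratios, all translations, two-sided bounds, eventually in the
integer scale) follows from BXP(δ) for `G` and for its dual `G*` — isoradial with BAP(ε)
(§2.2: `θ_{e*} = π - θ_e`) and SGP(I) (§4.2: "`G` satisfies SGP(I) if and only if `G*`
satisfies SGP(I)"), with canonical measure dual to `P_G` (§2.2: `p_e + p_{e*} = 1`) — by the
Harris–FKG reduction of §2.3 and planar duality, with constants depending on `(ε, I, ρ)` only
(details in the module docstring of the companion file `IsoradialPrintedBXP`).
*History.* Restated in place on 2026-08-15 (verdict clean-up). Until then the body read
`∀ ε > 0, ∀ ρ > 0, ∃ c > 0, ∃ n₀, ∀ G …, emb.HasBoundedAngles ε → emb.HasSquareGridProperty →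
BoxCrossingBounds …`, which is **stronger than the source** on two counts: the constants were
chosen from `(ε, ρ)` alone, i.e. uniformly over `⋃_I 𝒢(ε, I)` (the separation bound hidden as
`∃ M` inside the hypothesis), whereas the source chooses `δ = δ(ε, I)` after `I` ((3.1); §4.5;
§7: "there exists `δ = δ(ε, I) > 0`, independent of `G` and `N`", the box `H` there having width
at most `4 I N`; §8.5.1) and no published result gives `I`-free constants (weakening the
square-grid hypothesis is listed as open by Grimmett, Proc. ICM 2014, §5(D)); and the
square-grid hypothesis was the H21 rendering `RhombicEmbedding.HasSquareGridProperty`, strictly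
weaker than the printed SGP(I) (it drops clause (b); separating rhombic tiling in the module
docstring of `Literature.Probability.LatticeModels.IsoradialSquareGrid`), so the old body
concluded about a strictly larger class than Theorem 3.1 covers. The old body implies the
present one (`IsoradialPrintedBXP`, theorem `gm_boxCrossingBounds_uniform.toGM`, written
against the old body, has the present body as its conclusion); the converse is not available.
[cite: GrimmettManolescu2014Isoradial, §3 Theorem 3.1 with (3.1) (δ = δ(ε, I)); §2.3 Def. 2.2 (BXP); §4.2 (SGP(I), 𝒢(ε, I))] -/
def gm_boxCrossingBounds_uniform : Prop :=
  ∀ (ε : ℝ) (hε : 0 < ε) (I : ℕ) (ρ : ℝ) (hρ : 0 < ρ),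
    ∃ c > (0 : ℝ), ∃ n₀ : ℕ, ∀ (V F : Type) [Countable V] [DecidableEq V] [DecidableEq F]
      (G : SimpleGraph V) [G.LocallyFinite] (emb : RhombicEmbedding G F),
      G.Preconnected → emb.IsIsoradial → emb.IsRhombicTiling → emb.HasBoundedAngles ε →
      emb.SquareGridPropertyGM I → BoxCrossingBounds emb.isoradialPercolation emb.z ρ c n₀

section GM

variable {V F : Type*} [Countable V] [DecidableEq V] [DecidableEq F] (G : SimpleGraph V)
  [G.LocallyFinite] (emb : RhombicEmbedding G F) (ε : ℝ)

/-- **crit-perc.S24** (box-crossing property, per graph; Grimmett–Manolescu, PTRF 159 (2014)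
273–327 = arXiv:1204.0505, Thm 1.1(a), first half = §3, Theorem "box-crossing property"
(arXiv:1204.0505v2: Theorem 3): "For `G ∈ 𝒢`, `P_G` possesses the box-crossing property", where
`𝒢` is "the class of isoradial graphs with the bounded-angles property and the square-grid
property" (§3, first sentence; §2.1: BAP(ε); §4.2: the square-grid property SGP = "SGP(I) for
some `I ∈ ℕ`", SGP(I) asking that the track-set be partitioned as `S ∪ T₁ ∪ T₂` with clauses
(a)–(c); tree: `RhombicEmbedding.HasSquareGridPropertyGM` of `IsoradialSquareGrid`)). Statement
(per graph; `G`, `emb`, `ε` explicit): for a preconnected graph isoradially and rhombically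
embedded with the bounded-angles property `HasBoundedAngles ε`, `0 < ε`, and the **printed**
square-grid property `HasSquareGridPropertyGM` — i.e. `G ∈ 𝒢` —, the canonical bond
percolation measure `P_G` has the box-crossing (RSW) property: rectangles of any fixed aspect
ratio are crossed, horizontally and vertically, with probability bounded away from `0` and `1`
uniformly in the position `w` and the (large) scale `n` (`HasBoxCrossingProperty`, the two-sided
rendering of BXP, §2.3 Def. 2.2). The uniformity in `G ∈ 𝒢(ε, I)` (display (3.1)) is
`gm_boxCrossingBounds_uniform`; this is the per-graph (universe-polymorphic) form. Its base case
`ℤ²` (§2.3 after Def. 2.2, Russo–Seymour–Welsh; §4.3.1, `ℤ² ∈ 𝒢`) is proved outright in the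
companion file `IsoradialBoxCrossingGM` (`gm_boxCrossing_squareLattice`), which also derives the
present statement, for graphs on types in `Type`, from `gm_boxCrossingBounds_uniform`
(`hasBoxCrossingProperty_of_gm_boxCrossingBounds_uniform_of_hasSquareGridPropertyGM`).
*History.* Restated in place on 2026-08-15 (verdict clean-up, together with
`gm_theta_critical_eq_zero`; same human ruling as for `gm_boxCrossingBounds_uniform`). Until then
the square-grid hypothesis read `(hsgp : emb.HasSquareGridProperty)` — the H21 rendering of
`IsoradialGraphs`, which is **strictly weaker** than the printed SGP: it drops, from clause (b),
that *every* track outside a grid family crosses *all* tracks of that family, in index order, and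
the rhombic tiling "`ℤ²` plus one staircase track" of the module docstring of
`IsoradialSquareGrid` satisfies it, and every other hypothesis, while possessing no square grid
in the printed sense — so the old body asserted the box-crossing property for a strictly larger
class of graphs than the Theorem covers, whose printed proof (§7) uses clause (b) essentially
("any `r ∈ 𝒯` [not parallel to `s₀`] intersects both `s₀` and `s₁` exactly once"); on the extra
graphs the property is not settled in print (weakening the square-grid hypothesis is listed as
open by Grimmett, Proc. ICM 2014 = arXiv:1404.2831, §5(D)). The record written before the
restatement is the module docstring of `IsoradialBoxCrossingGM` (whose displayed
`gm_boxCrossingGM` is the present body). The old body implies the present one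
(`gm_boxCrossing.of_hasSquareGridProperty` below, through
`HasSquareGridPropertyGM.hasSquareGridProperty`); the converse is not available.
[cite: GrimmettManolescu2014Isoradial, §3 main Theorem (box-crossing property for G ∈ 𝒢; arXiv:1204.0505v2 Thm 3); §2.3 Def. 2.2 (BXP); §4.2 (SGP(I), SGP, 𝒢)] -/
def gm_boxCrossing : Prop :=
  ∀ (hconn : G.Preconnected) (hiso : emb.IsIsoradial) (hrh : emb.IsRhombicTiling) (hε : 0 < ε)
    (hbap : emb.HasBoundedAngles ε) (hsgp : emb.HasSquareGridPropertyGM),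
    HasBoxCrossingProperty emb.isoradialPercolation emb.z

/-- **crit-perc.S24** (`θ(p_c) = 0`; Grimmett–Manolescu, PTRF 159 (2014) 273–327 =
arXiv:1204.0505, Thm 1.1(a), second assertion ("`P_G` is critical") = §3, Theorem "Criticality"
(b) (arXiv:1204.0505v2: Theorem 4 (b)): "Let `G = (V, E) ∈ 𝒢 […]. (b) There exists,
`P_G`-a.s., no infinite open cluster", where `𝒢` is "the class of isoradial graphs with the
bounded-angles property and the square-grid property" (§3, first sentence; §2.1: BAP(ε); §4.2:
SGP = "SGP(I) for some `I ∈ ℕ`", the track-set partitioned as `S ∪ T₁ ∪ T₂` with clauses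
(a)–(c); tree: `RhombicEmbedding.HasSquareGridPropertyGM` of `IsoradialSquareGrid`); printed
proof, end of §3: "both `P_G` and `P_{G*}` have the box-crossing property. The claims then
follow as in [GM1]"). Statement (per graph, `θ = 0` rendered vertexwise): for a preconnected
graph `G`, isoradially and rhombically embedded with the bounded-angles property
`HasBoundedAngles ε`, `0 < ε`, and the **printed** square-grid property `HasSquareGridPropertyGM`
— i.e. `G ∈ 𝒢` —, under the canonical measure `P_G` every vertex `x` lies in an infinite open
cluster with probability `0` (`percolatesAt`). The deduction from the box-crossing property is
proved in the companion file `IsoradialCriticalityProofs`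
(`gm_theta_critical_eq_zero_of_hasBoxCrossingProperty`, which does not use the square-grid
property, whence `gm_theta_critical_eq_zero_of_gm_boxCrossing : gm_boxCrossing G emb ε →
gm_theta_critical_eq_zero G emb ε` under `Countable V`), and the base case `ℤ²` holds outright
(`IsoradialCriticalitySquare`); what is not proved in the tree is the box-crossing Theorem itself
(`gm_boxCrossing`, `gm_boxCrossingBounds_uniform`: the star–triangle transport of §§5–7).
*History.* Restated in place on 2026-08-15 (verdict clean-up on review of this fact, together
with `gm_boxCrossing`; same human ruling as for `gm_boxCrossingBounds_uniform`,
`gm_universality_oneArm`). Until then the square-grid hypothesis read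
`(hsgp : emb.HasSquareGridProperty)` — the H21 rendering, strictly weaker than the printed SGP
(see the `History` paragraph of `gm_boxCrossing`) — so the old body asserted `θ(P_G) = 0` for a
strictly larger class of graphs than Theorem "Criticality" (b) covers; on the extra graphs the
conclusion is plausible but not proved in print, the printed proof going through the box-crossing
Theorem. The record written before the restatement is the section "The statement of
`gm_theta_critical_eq_zero` against its source" of `IsoradialCriticalityProofs` (theorem
`gm_theta_critical_eq_zero.toGM`, whose conclusion is the present body). The old body implies the
present one (`gm_theta_critical_eq_zero.of_hasSquareGridProperty` below, through
`HasSquareGridPropertyGM.hasSquareGridProperty`); the converse is not available.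
[cite: GrimmettManolescu2014Isoradial, §3 Theorem "Criticality" (b) (arXiv:1204.0505v2 Thm 4 (b)), proof at the end of §3; §4.2 (SGP(I), SGP, 𝒢)] -/
def gm_theta_critical_eq_zero : Prop :=
  ∀ (hconn : G.Preconnected) (hiso : emb.IsIsoradial) (hrh : emb.IsRhombicTiling) (hε : 0 < ε)
    (hbap : emb.HasBoundedAngles ε) (hsgp : emb.HasSquareGridPropertyGM) (x : V),
    emb.isoradialPercolation (percolatesAt x) = 0

/-- **crit-perc.S24** (universality of the one-arm exponent; Grimmett–Manolescu, PTRF 159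
(2014) 273–327 = arXiv:1204.0505, §3, Theorem "Universality" (a) for `π = ρ` (`ρ = 1/ρ₁`):
"if `π` exists for some `G ∈ 𝒢`, then it is `𝒢`-invariant", `𝒢` being the class of isoradial
graphs with the bounded-angles property and the square-grid property **as printed** (§4.2:
SGP(I) for some `I`, the track-set partitioned as `S ∪ T₁ ∪ T₂` with clauses (a)–(c); tree:
`RhombicEmbedding.HasSquareGridPropertyGM` of `IsoradialSquareGrid`), proved through §8.1,
Proposition (exp_transport): for `G ∈ 𝒢(ε, I)` the arm probabilities `P_G[A_k^u(N, n)]` are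
comparable, uniformly in `G` and in the centre `u`, with those of the isoradial square
lattice). Statement (per graph; `G`, `emb`, `ε` explicit): for a countable, locally finite,
preconnected graph `G`, isoradially and rhombically embedded with `HasBoundedAngles ε`,
`0 < ε`, and `HasSquareGridPropertyGM` — i.e. `G ∈ 𝒢` —, if for *some* such graph `G₀` (on a
type in `Type`, with its own `ε₀`) the one-arm probability satisfies
`P_{G₀}(Λ_2 ↔ ∂Λ_n) = n^{-α + o(1)}` (`HasDecayExponent` of `embOneArm`), then
`P_G(Λ_2 ↔ ∂Λ_n) = n^{-α + o(1)}` with the same `α = ρ₁`. The rendering of "`ρ₁` exists" by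
the log-ratio limit of the origin-centred event `embOneArm` (rather than uniformly in the
centre, §3) is that of the original transcription; for graphs in `𝒢` the rendered implication
follows from Proposition (exp_transport) with Proposition (exp_equiv) and the box-crossing
property (details in the module docstring of the companion file `IsoradialPrintedSGP`).
*History.* Restated in place on 2026-08-15 (verdict clean-up). Until then the square-grid
hypothesis was the H21 rendering `RhombicEmbedding.HasSquareGridProperty`, both for `G` and
for the witness `G₀`, and the (unused) section instances `[Countable V]`, `[G.LocallyFinite]`
were not part of the elaborated statement; since §3 Theorem "Universality" (a) is proved for
the printed class `𝒢`, whose clause (b) the rendering drops and the proof uses (§8.4: "write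
`(r_i : i ∈ ℤ)` for the sequence of all tracks other than the `s_j`, indexed … according to
their intersections with `s_0`"; "since each `r_i` intersects each `s_j`"), enlarging the
class at either occurrence made the old body **logically stronger than what is printed**. The
old body implies the present one (`IsoradialPrintedSGP`, theorem
`gm_universality_oneArm.toGM`, written against the old body, has the present body — up to the
annotation of the two instance binders — as its conclusion); the converse is not available.
[cite: GrimmettManolescu2014Isoradial, §3 Theorem "Universality" (a), π = ρ; §4.2 (SGP, 𝒢); §8.1 Prop. (exp_transport)] -/
def gm_universality_oneArm : Prop :=
  ∀ [Countable V] [G.LocallyFinite] (hconn : G.Preconnected) (hiso : emb.IsIsoradial)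
    (hrh : emb.IsRhombicTiling) (hε : 0 < ε) (hbap : emb.HasBoundedAngles ε)
    (hsgp : emb.HasSquareGridPropertyGM) (α : ℝ)
    (h : ∃ (V₀ F₀ : Type) (_ : Countable V₀) (_ : DecidableEq V₀) (_ : DecidableEq F₀)
      (G₀ : SimpleGraph V₀) (_ : G₀.LocallyFinite) (emb₀ : RhombicEmbedding G₀ F₀) (ε₀ : ℝ),
      G₀.Preconnected ∧ emb₀.IsIsoradial ∧ emb₀.IsRhombicTiling ∧ 0 < ε₀ ∧
        emb₀.HasBoundedAngles ε₀ ∧ emb₀.HasSquareGridPropertyGM ∧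
        HasDecayExponent (fun n => emb₀.isoradialPercolation.real (embOneArm emb₀.z n)) α),
    HasDecayExponent (fun n => emb.isoradialPercolation.real (embOneArm emb.z n)) α

/-- **crit-perc.S24** (universality of the alternating `2j`-arm exponents; Grimmett–Manolescu,
PTRF 159 (2014) 273–327 = arXiv:1204.0505, §3, Theorem 6 "Universality" (a) for `π = ρ_{2j}`,
`j ≥ 1`: "Let `π ∈ {ρ} ∪ {ρ_{2j} : j ≥ 1}`. If `π` exists for some `G ∈ 𝒢`, then it is
`𝒢`-invariant", where (§3) `ρ_{2j}` is defined by `P_G[A_σ^v(N, n)] ≈ n^{-ρ_{2j}}` (log-ratio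
asymptotics) for the *alternating* colour sequences `σ = (1, 0, 1, 0, …)` of length `2j`, the
arm event `A_σ(N, n)` being "the event that there exist `k` vertex-disjoint crossings
`γ_1, …, γ_k` of `𝒜(N, n)` with colours `σ_i` taken in anticlockwise order" (`1` = primal open,
`0` = dual open), and `𝒢` is the class of isoradial graphs with the bounded-angles property
and the square-grid property **as printed** (§4.2: SGP(I) for some `I`, the track-set
partitioned as `S ∪ T₁ ∪ T₂` with clauses (a)–(c); tree:
`RhombicEmbedding.HasSquareGridPropertyGM` of `IsoradialSquareGrid`); printed proof: §8.1,
"Part (a) … is an immediate consequence" of Proposition 22 (exp_transport), the arm events being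
handled in the cluster-separated form `Ã_{2j}` of §8.2: "`x_i ↔ y_i` and `x_i ↮ x_{i'}` for
`i ≠ i'`"). Statement (per graph; `G`, `emb`, `ε` explicit): for a countable, locally finite,
preconnected graph `G`, isoradially and rhombically embedded with `HasBoundedAngles ε`, `0 < ε`,
and `HasSquareGridPropertyGM` — i.e. `G ∈ 𝒢` — and for `j ≥ 1`: if for *some* such graph `G₀`
(on a type in `Type`, with its own `ε₀`) and every large enough (then fixed) inner radius `r₀`
the probability of the alternating `2j`-arm event `embAltArmEvent j r₀ R` of
`IsoradialArmUniversality` — `j` open crossings of the annulus `Λ_R ∖ Λ_{r₀}` lying in pairwise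
distinct open clusters of the annulus and `j` dual-open crossings lying in pairwise distinct
dual-open clusters of it: the rendering of `A_{2j}(r₀, R)`, the cyclic alternation being
encoded by cluster separation as in §8.2 — is `R^{-α + o(1)}` as `R → ∞` (`HasDecayExponent`),
then the same holds, with the same `α = ρ_{2j}`, for `G`. Rendering notes (shared with
`gm_universality_oneArm`; not defects): the events are centred at the origin of `ℂ` rather than
stated uniformly in a centre `v ∈ G^◇` (§3; for `G ∈ 𝒢(ε, I)` Proposition 22 is uniform in the
centre); boxes are sup-norm boxes with slack `2` (a configuration in `A_{2j}(r₀ - 2, R + 2)`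
lies in `embAltArmEvent j r₀ R`, the first and last vertices of an arc crossing the closed
annulus being within edge-length `2` of its boundary; by §8.2, Proposition 23 (exp_equiv),
changing `N` or `n` by a bounded factor changes `P[A_k(N, n)]` by a bounded factor, to which
log-ratio limits are insensitive); the inner radius is "large enough, then fixed"
(`∃ r₁, ∀ r₀ ≥ r₁`; GM: "`N = N(σ)` is taken sufficiently large that the events are
non-empty"). What is proved in the tree: the present statement follows from Proposition 22
(the named facts `GrimmettManolescu2014_armComparability_one_two`,
`GrimmettManolescu2014_altArmComparability`) for embeddings on `Type` with a diamond vertex at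
the origin (`gm_universality_altArms_centred`, `IsoradialExponentUniversality`); Proposition 22
itself (§§5–8: star–triangle transport, separation theorem, box crossings) is not.
*History.* Restated in place on 2026-08-15 (review of the `provefact` verdict *misstated*; the
corrected statement had been recorded as text, under the working name `gm_universality_altArms`,
in the module docstring of `IsoradialArmUniversality`). Until then the body read
`∀ (hconn : G.Preconnected) (hiso : emb.IsIsoradial) (hrh : emb.IsRhombicTiling) (hε : 0 < ε)
(hbap : emb.HasBoundedAngles ε) (hsgp : emb.HasSquareGridProperty) (j : ℕ) (hj : 1 ≤ j) (α : ℝ)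
(h : ∃ (V₀ F₀ : Type) (_ : Countable V₀) (_ : DecidableEq V₀) (_ : DecidableEq F₀)
(G₀ : SimpleGraph V₀) (_ : G₀.LocallyFinite) (emb₀ : RhombicEmbedding G₀ F₀) (ε₀ : ℝ),
G₀.Preconnected ∧ emb₀.IsIsoradial ∧ emb₀.IsRhombicTiling ∧ 0 < ε₀ ∧ emb₀.HasBoundedAngles ε₀ ∧
emb₀.HasSquareGridProperty ∧ ∃ r₁ : ℕ, ∀ r₀ ≥ r₁, HasDecayExponent (fun R =>
emb₀.isoradialPercolation.real (emb₀.embArmEvent (alternatingColours j) r₀ R)) α), ∃ r₁ : ℕ,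
∀ r₀ ≥ r₁, HasDecayExponent (fun R => emb.isoradialPercolation.real (emb.embArmEvent
(alternatingColours j) r₀ R)) α`, which is **not the statement of the source**, on two counts.
(D1, the event.) The prelude's event `RhombicEmbedding.embArmEvent (alternatingColours j) r₀ R`
(`IsoradialPercolation`) asks for `j` pairwise vertex-disjoint open crossings and `j` pairwise
vertex-disjoint dual-open crossings of the annulus and imposes *no cyclic order* (its docstring
says so); for `j ≥ 2` it is the union over all colour patterns with `j` arms of each kind
(open, open, dual, dual, … included), strictly larger than `A_{2j}` — on `√2 ℤ² ∈ 𝒢`,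
`embAltArmEvent 2 2 3 ⊂ embArmEvent (alternatingColours 2) 2 3`
(`embAltArmEvent_two_ssubset_embArmEvent`, witness `ladderConfig`: two open crossings in *one*
open cluster; `IsoradialPrintedArms`). No published result asserts the universality of the
exponent of that event (for a general colour sequence `σ` both the existence and the
`𝒢`-invariance of `ρ(σ, G)` are Conjecture 5 of §3, of which Theorem 6(a) "amounts to a
verification of (b) … for colour sequences which are either of length one or alternating"),
and the printed proof does not cover it (§8.2–8.4: the star–triangle transformations transport
open paths and preserve the (non-)connection of clusters — "these clusters neither break nor
merge" —, whence the modified events `Ã_k`; vertex-disjointness of arms inside one cluster is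
not preserved). For `j ≥ 2` neither body implies the other; at `j = 1` the two events coincide
(`RhombicEmbedding.embAltArmEvent_one_eq`, `IsoradialPrintedArms`;
`RhombicEmbedding.embArmEvent_alternatingColours_one`, `IsoradialArmUniversalityProofs`: one open
and one dual-open crossing are always "alternating in anticlockwise order"), and there the old
body implies the present one through `HasSquareGridPropertyGM.hasSquareGridProperty`.
(D2, the class.) The square-grid hypothesis, at `G` and at the witness `G₀`, was the H21
rendering `RhombicEmbedding.HasSquareGridProperty`, strictly weaker than the printed SGP
(section "The square-grid hypothesis" at the end of this file; it drops clause (b), which §8.4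
uses: "since each `r_i` intersects each `s_j`"), making the body at either occurrence *stronger*
than the source — the defect corrected in place in the four siblings —, and the (unused) section
instances `[Countable V]`, `[G.LocallyFinite]` were not part of the elaborated statement, as for
`gm_universality_oneArm` before its restatement.
[cite: GrimmettManolescu2014Isoradial, §3 Theorem 6 "Universality" (a), π = ρ_{2j}; §3 (A_σ(N,n): colours in anticlockwise order; A_{2j}); §4.2 (SGP(I), 𝒢); §8.1 (Prop. 22), §8.2 (Ã_{2j}, Prop. 23)] -/
def gm_universality_arms : Prop :=
  ∀ [Countable V] [G.LocallyFinite] (hconn : G.Preconnected) (hiso : emb.IsIsoradial)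
    (hrh : emb.IsRhombicTiling) (hε : 0 < ε) (hbap : emb.HasBoundedAngles ε)
    (hsgp : emb.HasSquareGridPropertyGM) (j : ℕ) (hj : 1 ≤ j) (α : ℝ)
    (h : ∃ (V₀ F₀ : Type) (_ : Countable V₀) (_ : DecidableEq V₀) (_ : DecidableEq F₀)
      (G₀ : SimpleGraph V₀) (_ : G₀.LocallyFinite) (emb₀ : RhombicEmbedding G₀ F₀) (ε₀ : ℝ),
      G₀.Preconnected ∧ emb₀.IsIsoradial ∧ emb₀.IsRhombicTiling ∧ 0 < ε₀ ∧
        emb₀.HasBoundedAngles ε₀ ∧ emb₀.HasSquareGridPropertyGM ∧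
        ∃ r₁ : ℕ, ∀ r₀ ≥ r₁, HasDecayExponent
          (fun R => emb₀.isoradialPercolation.real (emb₀.embAltArmEvent j r₀ R)) α),
    ∃ r₁ : ℕ, ∀ r₀ ≥ r₁, HasDecayExponent
      (fun R => emb.isoradialPercolation.real (emb.embAltArmEvent j r₀ R)) α

end GM

/-- **crit-perc.S24** (the square lattice belongs to the class; Grimmett–Manolescu, PTRF 159
(2014), §1, after (1.3): "includes `ℤ²` at `p = 1/2`"). Every canonical edge weight of the
isoradial embedding of `ℤ²` is `1/2`, so the canonical measure is critical bond percolation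
`P_{1/2}` on `ℤ²`; together with `zdGraph_preconnected`, `isIsoradial_squareLatticeEmbedding`,
`isRhombicTiling_squareLatticeEmbedding`, `hasBoundedAngles_squareLatticeEmbedding` and
`hasSquareGridPropertyGM_squareLattice` (printed SGP(1), `IsoradialSquareGrid`) this puts `ℤ²`
at `p = 1/2` in the scope of `gm_boxCrossing`–`gm_universality_arms`. [folklore] -/
def isoradialPercolation_square_eq : Prop :=
  squareLatticeEmbedding.isoradialPercolation = bondPercolation (zdGraph 2) half

/- interim proof relied on results that are now named facts (D-0014); demoted to a fact by the M5 import, proof preserved: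
:=
  RhombicEmbedding.isoradialPercolation_squareLattice
-/

/-- Sanity corollary: critical bond percolation on `ℤ²` has the box-crossing property in the
embedded sense of `HasBoxCrossingProperty` (Grimmett–Manolescu 2014, Thm 1.1(a) specialised via
`isoradialPercolation_square_eq`; originally Russo 1978, Seymour–Welsh 1978).
[cite: GrimmettManolescu2014Isoradial, §3 Theorem "box-crossing property"] -/
def square_boxCrossing : Prop :=
  HasBoxCrossingProperty (bondPercolation (zdGraph 2) half) squareLatticeEmbedding.z

/- interim proof relied on results that are now named facts (D-0014); demoted to a fact by the M5 import, proof preserved: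
:= by
  rw [← isoradialPercolation_square_eq]
  exact gm_boxCrossing (zdGraph 2) squareLatticeEmbedding (Real.pi / 4) zdGraph_preconnected
    isIsoradial_squareLatticeEmbedding isRhombicTiling_squareLatticeEmbedding (by positivity)
    (hasBoundedAngles_squareLatticeEmbedding le_rfl) hasSquareGridProperty_squareLattice
-/

end Literature.Probability.Percolation

/-! ### The square-grid hypothesis: printed SGP versus the H21 rendering

Until their restatement in place (2026-08-15, see their `History` paragraphs) the per-graph facts
`gm_boxCrossing` and `gm_theta_critical_eq_zero` hypothesised — as did `gm_universality_arms`
until its own restatement — the H21 rendering `RhombicEmbedding.HasSquareGridProperty` of the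
square-grid property.
The clause-by-clause check recorded in `Literature.Probability.LatticeModels.IsoradialSquareGrid`
shows that this rendering is *strictly weaker* than the printed SGP(I) of Grimmett–Manolescu
(§4.2): it drops, from clause (b), that *every* track of the graph outside a grid family crosses
*all* tracks of that family, in index order. That clause is used essentially in the printed
proof (§7, proof of the box-crossing Theorem for general graphs: "Any `r ∈ 𝒯` [not parallel to
`s₀`] intersects both `s₀` and `s₁` exactly once", "Since each `r_i` intersects each `s_j` …
`G_{α,β}` is an isoradial square lattice"; likewise Duminil-Copin–Li–Manolescu, EJP 23 (2018),
§2, definition of a *grid*: "all tracks of `𝔾` not in `(t_n)` intersect all those of `(t_n)`"),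
and the rhombic tiling "`ℤ²` plus one staircase track" of that module docstring satisfies every
hypothesis of the old bodies (preconnected, isoradial, rhombic tiling, bounded angles — rhombus
angles `π/4, π/2, 3π/4` —, and `HasSquareGridProperty` with `M = 1`) while possessing *no*
square grid in the printed sense, so it lies outside the class `𝒢` of the source; whether the
box-crossing property and `θ = 0` hold on such graphs is not settled in print. The theorems
`gm_boxCrossing.hasBoxCrossingProperty_of_hasSquareGridPropertyGM` and
`gm_theta_critical_eq_zero.percolatesAt_eq_zero_of_hasSquareGridPropertyGM` below were landed
before the restatement, as the faithful statements derived from the then over-strong facts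
through `HasSquareGridPropertyGM.hasSquareGridProperty`; since the restatement they are the facts
unfolded, kept under their names because the companion file `IsoradialCriticalityProofs`
(`gm_theta_critical_eq_zero_printed_of_gm_boxCrossing`, `gm_theta_critical_eq_zero.toGM`) goes
through them. The records `gm_boxCrossing.of_hasSquareGridProperty` and
`gm_theta_critical_eq_zero.of_hasSquareGridProperty` (superseded body ⇒ present body) fix the
direction of the correction: the superseded bodies were the *stronger* statements, and the
converse implications are not available. The same remark applied likewise to
`gm_boxCrossingBounds_uniform` (whose constants, moreover, are printed as `δ = δ(ε, I)`, (3.1),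
not uniform in `I`), to `gm_universality_oneArm` and to `gm_universality_arms` (for `G` and for
the witness `G₀`; its arm event was moreover not the alternating one, companion file
`IsoradialPrintedArms`) until their restatement in place with the printed hypothesis
(2026-08-15, see their docstrings).
-/

namespace Literature.Probability.Percolation

open LatticeModels Percolation

section GMPrinted

variable {V F : Type*} [DecidableEq V] [DecidableEq F] (G : SimpleGraph V)
  (emb : RhombicEmbedding G F) (ε : ℝ)

/-- **The box-crossing Theorem for the printed class `𝒢`, elimination form of `gm_boxCrossing`**
(Grimmett–Manolescu, PTRF 159 (2014) 273–327, Thm 1.1(a) = arXiv:1204.0505 §3, Theorem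
"box-crossing property" (v2: Theorem 3): "For `G ∈ 𝒢`, `P_G` possesses the box-crossing
property", `𝒢` = isoradial graphs with BAP(ε) for some `ε > 0` (§2.1) and SGP = "SGP(I) for some
`I`" (§4.2)). For a preconnected graph isoradially and rhombically embedded with BAP(ε),
`0 < ε`, and the **printed** square-grid property `HasSquareGridPropertyGM` (track-set
partitioned as `S ∪ T₁ ∪ T₂`, clauses (a)–(c) of §4.2), the fact `gm_boxCrossing G emb ε` gives
the box-crossing property `HasBoxCrossingProperty` of the canonical measure `P_G`. Landed before
the restatement of `gm_boxCrossing` (2026-08-15) as the faithful statement derived from the then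
over-strong fact (through `HasSquareGridPropertyGM.hasSquareGridProperty`, see the section
docstring); since the restatement it is the fact unfolded, kept under its name as the entry point
of `IsoradialCriticalityProofs` (`gm_theta_critical_eq_zero_printed_of_gm_boxCrossing`).
[cite: GrimmettManolescu2014Isoradial, §3 Thm 3.1 (box-crossing property for 𝒢); §4.2 (SGP(I))] -/
theorem gm_boxCrossing.hasBoxCrossingProperty_of_hasSquareGridPropertyGM
    (h : gm_boxCrossing G emb ε) (hconn : G.Preconnected) (hiso : emb.IsIsoradial)
    (hrh : emb.IsRhombicTiling) (hε : 0 < ε) (hbap : emb.HasBoundedAngles ε)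
    (hsgp : emb.HasSquareGridPropertyGM) :
    HasBoxCrossingProperty emb.isoradialPercolation emb.z :=
  h hconn hiso hrh hε hbap hsgp

/-- **The superseded body of `gm_boxCrossing` implies the present one.** If the box-crossing
property of `P_G` followed from preconnectedness, isoradiality, the rhombic-tiling condition,
BAP(ε) with `0 < ε` and the *H21 rendering* `HasSquareGridProperty` of the square-grid property
— the hypothesis `h` is verbatim the body of `gm_boxCrossing` before its restatement of
2026-08-15 —, then `gm_boxCrossing G emb ε` (printed class `𝒢`) holds, because the printed SGP
implies the H21 rendering (`HasSquareGridPropertyGM.hasSquareGridProperty`; Grimmett–Manolescu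
2014, §4.2, compared clause by clause in `IsoradialSquareGrid`). Record of the direction of the
restatement (the superseded body was the *stronger* statement); the converse is not available.
[cite: GrimmettManolescu2014Isoradial, §4.2 (SGP(I), clause (b)) with §3 Thm 3.1 (box-crossing property for 𝒢)] -/
theorem gm_boxCrossing.of_hasSquareGridProperty
    (h : ∀ (_ : G.Preconnected) (_ : emb.IsIsoradial) (_ : emb.IsRhombicTiling) (_ : 0 < ε)
      (_ : emb.HasBoundedAngles ε) (_ : emb.HasSquareGridProperty),
      HasBoxCrossingProperty emb.isoradialPercolation emb.z) :
    gm_boxCrossing G emb ε :=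
  fun hconn hiso hrh hε hbap hsgp => h hconn hiso hrh hε hbap hsgp.hasSquareGridProperty

/-- **Theorem "Criticality" (b) for the printed class `𝒢`, elimination form of
`gm_theta_critical_eq_zero`** (Grimmett–Manolescu, PTRF 159 (2014) 273–327 = arXiv:1204.0505,
§3, Theorem "Criticality" (b) (v2: Theorem 4 (b)): "Let `G ∈ 𝒢` […]. There exists, `P_G`-a.s.,
no infinite open cluster", `𝒢` = isoradial graphs with BAP(ε) for some `ε > 0` (§2.1) and SGP =
"SGP(I) for some `I`" (§4.2)). For a preconnected graph isoradially and rhombically embedded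
with BAP(ε), `0 < ε`, and the **printed** square-grid property `HasSquareGridPropertyGM`
(track-set partitioned as `S ∪ T₁ ∪ T₂`, clauses (a)–(c) of §4.2), the fact
`gm_theta_critical_eq_zero G emb ε` gives that every vertex `x` lies in an infinite open cluster
with `P_G`-probability `0` (`percolatesAt`). Landed before the restatement of
`gm_theta_critical_eq_zero` (2026-08-15) as the faithful statement derived from the then
over-strong fact (through `HasSquareGridPropertyGM.hasSquareGridProperty`, see the section
docstring); since the restatement it is the fact unfolded, kept under its name because
`IsoradialCriticalityProofs` (`gm_theta_critical_eq_zero.toGM`) goes through it. Companion of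
`gm_boxCrossing.hasBoxCrossingProperty_of_hasSquareGridPropertyGM`.
[cite: GrimmettManolescu2014Isoradial, §3 Theorem "Criticality" (b) (arXiv:1204.0505: Theorem 4 (b)); §4.2 (SGP(I), SGP, 𝒢)] -/
theorem gm_theta_critical_eq_zero.percolatesAt_eq_zero_of_hasSquareGridPropertyGM
    (h : gm_theta_critical_eq_zero G emb ε) (hconn : G.Preconnected) (hiso : emb.IsIsoradial)
    (hrh : emb.IsRhombicTiling) (hε : 0 < ε) (hbap : emb.HasBoundedAngles ε)
    (hsgp : emb.HasSquareGridPropertyGM) (x : V) :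
    emb.isoradialPercolation (percolatesAt x) = 0 :=
  h hconn hiso hrh hε hbap hsgp x

/-- **The superseded body of `gm_theta_critical_eq_zero` implies the present one.** If
`P_G(x ↔ ∞) = 0` for every vertex followed from preconnectedness, isoradiality, the
rhombic-tiling condition, BAP(ε) with `0 < ε` and the *H21 rendering* `HasSquareGridProperty`
of the square-grid property — the hypothesis `h` is verbatim the body of
`gm_theta_critical_eq_zero` before its restatement of 2026-08-15 —, then
`gm_theta_critical_eq_zero G emb ε` (printed class `𝒢`) holds, because the printed SGP implies
the H21 rendering (`HasSquareGridPropertyGM.hasSquareGridProperty`; Grimmett–Manolescu 2014,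
§4.2, compared clause by clause in `IsoradialSquareGrid`). Record of the direction of the
restatement (the superseded body was the *stronger* statement); the converse is not available.
[cite: GrimmettManolescu2014Isoradial, §4.2 (SGP(I), clause (b)) with §3 Theorem "Criticality" (b)] -/
theorem gm_theta_critical_eq_zero.of_hasSquareGridProperty
    (h : ∀ (_ : G.Preconnected) (_ : emb.IsIsoradial) (_ : emb.IsRhombicTiling) (_ : 0 < ε)
      (_ : emb.HasBoundedAngles ε) (_ : emb.HasSquareGridProperty) (x : V),
      emb.isoradialPercolation (percolatesAt x) = 0) :
    gm_theta_critical_eq_zero G emb ε :=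
  fun hconn hiso hrh hε hbap hsgp x => h hconn hiso hrh hε hbap hsgp.hasSquareGridProperty x

end GMPrinted

end Literature.Probability.Percolation

/-! ### The uniform statement, `I` by `I`

Kept from before the restatement of `gm_boxCrossingBounds_uniform` (2026-08-15): the theorem
below was landed, against the *old* body, as the record that the over-strong transcription
implies the printed `(ε, I)`-form; with the corrected body its conclusion is the fact itself,
instantiated at `(ε, I, ρ)`, and it is kept under its name because companion files
(`IsoradialPrintedBXP`, `IsoradialCriticalityProofs`) go through it.
-/

namespace Literature.Probability.Percolation

open LatticeModels Percolation

/-- **The uniform box-crossing fact at fixed `(ε, I, ρ)`** (Grimmett–Manolescu, PTRF 159 (2014)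
= arXiv:1204.0505, §3: Theorem 3.1 in its uniform form (3.1): for `ε > 0` and `I ∈ ℕ` there
exists `δ = δ(ε, I) > 0` such that every isoradial graph with BAP(ε) (§2.1) and SGP(I) (§4.2)
satisfies BXP(δ) (§2.3), whence by the Harris–FKG reduction of §2.3 the box-crossing property
for every aspect ratio `ρ`, with constants depending only on `(ε, I, ρ)`): for `ε > 0`,
`I : ℕ`, `ρ > 0` there are `c > 0`, `n₀`, chosen before the graph, such that for every
preconnected graph on a type in `Type`, isoradially and rhombically embedded with
`HasBoundedAngles ε` and the printed square-grid property `SquareGridPropertyGM I`,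
`BoxCrossingBounds emb.isoradialPercolation emb.z ρ c n₀` holds — the named fact
`gm_boxCrossingBounds_uniform` instantiated (since its restatement of 2026-08-15 this is an
unfolding; before, it was the reduction of the printed form to the over-strong transcription via
`RhombicEmbedding.SquareGridPropertyGM.hasSquareGridProperty`).
[cite: GrimmettManolescu2014Isoradial, §3 main Theorem, uniform form (3.1) (δ = δ(ε, I)); §2.3 (BXP(δ)); §4.2 (SGP(I))] -/
theorem gm_boxCrossingBounds_uniform.boxCrossingBounds_of_squareGridPropertyGM
    (h : gm_boxCrossingBounds_uniform) (ε : ℝ) (hε : 0 < ε) (I : ℕ) (ρ : ℝ) (hρ : 0 < ρ) :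
    ∃ c > (0 : ℝ), ∃ n₀ : ℕ, ∀ (V F : Type) [Countable V] [DecidableEq V] [DecidableEq F]
      (G : SimpleGraph V) [G.LocallyFinite] (emb : RhombicEmbedding G F),
      G.Preconnected → emb.IsIsoradial → emb.IsRhombicTiling → emb.HasBoundedAngles ε →
      emb.SquareGridPropertyGM I → BoxCrossingBounds emb.isoradialPercolation emb.z ρ c n₀ :=
  h ε hε I ρ hρ

end Literature.Probability.Percolation
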